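import Summits.BirchSwinnertonDyer.BirchSwinnertonDyer.Theorems.AdditiveKolyvaginRoadKolyvaginPrimitiveOfIndexLowerBound
import Summits.BirchSwinnertonDyer.BirchSwinnertonDyer.Theorems.AdditiveKolyvaginRoadAssembly
import Summits.BirchSwinnertonDyer.BirchSwinnertonDyer.Theorems.AdditiveKolyvaginRoadAdditiveKolyvaginKernel
import HarnessLib

/-!
# Route `AdditiveKolyvaginRoad`: KOLYVAGIN'S CONJECTURE MOD `p` (crux r2 KPA′) ⟺ THE HEEGNER-INDEX LOWER BOUND (ILBᵃᵈᵈ),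
# modulo the published inputs — the converse half and the assembly reading (cell `pub/bsd-wall`, width seat `bsd-wall-akr-p2x-w2` g5;
# sequel of `AdditiveKolyvaginRoadKolyvaginPrimitiveOfIndexLowerBound`; `--supports stmt-BirchSwinnertonDyer-21400`, helper)

THEOREMS ONLY (no definition, no named fact, no `sorry`); every published input, Kolyvagin's conjecture mod `p` and the Heegner-index
lower bound are HYPOTHESES ∕ CONCLUSIONS of implications.  BSD is not proved by any of this; KPA′, KS′, BOT′, r3–r5 stay OPEN.

* §4 `wAllExclAdditive_of_indexLowerBound` — the route's leaf `WAllExclAdditive` (W-ALL row 2) from ILBᵃᵈᵈ + McCallum's divisibility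
  half + PUB + the OTHER cruxes r3 `RankZeroAdditive`, r4 `OffSharpRankOneAdditive`, r5 `AdditiveAtThree` and the Manin frame
  `ManinGoodOddFrameAdditive`, through the PROVED assembly (item 20139) and kernel (item 20138): no KS′, no BOT′, no E-side glue.
* §5 `indexLowerBoundAt_of_exists_kolyvaginClass_ne_zero` (one frame) and `kolyvaginPrimitiveAdditive_iff_indexLowerBound` (class
  level): the CONVERSE — a non-zero mod-`p` Kolyvagin class is a McCallum certificate at exponent `0`, whence `2·ord_p [E(K):ℤy_K] ≤
  ord_p #Ш(E/K)[p^∞]` (Cor. 5.6, certificate half, 9th conjunct of PUB), i.e. the lower bound with room to spare; so modulo PUB and the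
  divisibility half, `KolyvaginPrimitiveAdditive ↔ ILBᵃᵈᵈ`.  Re-keying r2 as ILBᵃᵈᵈ changes the currency (index inequality = output
  shape of the printed BDP ∕ anticyclotomic-IMC engines), not the strength — a reading for the pen, not acted on here.

References (locators only): [cite: McCallumLMS1991, §5 Lemma 5.1 and Cor. 5.6 (p. 310), §4 Cor. 4.5] [cite: GrossLMS1991, (1.1), Thm. 1.3]
[cite: JetchevSkinnerWan2017, §7.4.1–7.4.3] [cite: Castella2018, (1.1)] [cite: WZhang2014, Thm. 1.1, §9] [cite: SerreAbelianLadic1968, IV-23 Lemma 3].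
-/

-- single-conjunct summit: `Summit.BirchSwinnertonDyer.BirchSwinnertonDyer.…` repeats the name by design
set_option linter.dupNamespace false

set_option autoImplicit false

noncomputable section

open scoped Classical

namespace Summit.BirchSwinnertonDyer.BirchSwinnertonDyer.Theorems.AdditiveKoly

open WeierstrassCurve NumberField Field
  Literature.NumberTheory.EllipticCurves Literature.NumberTheory.EllipticCurves.ModularForms
  Literature.NumberTheory.EllipticCurves.Rank1Residual Literature.NumberTheory.EllipticCurves.KolyvaginCocycle
  Summit.BirchSwinnertonDyer.Rank1Residual Summit.BirchSwinnertonDyer.Rank1Residual.X11b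
  Summit.BirchSwinnertonDyer.Rank1Residual.X11b.Three
  Summit.BirchSwinnertonDyer.BirchSwinnertonDyer.Theses.AdditiveKolyvaginRoad

/-! ## §4 The rung, read through the proved assembly: W-ALL row 2 from ILBᵃᵈᵈ and the remaining cruxes -/

/-- **THE ROUTE'S LEAF FROM ILBᵃᵈᵈ IN PLACE OF THE KOLYVAGIN-SYSTEM CRUXES.**  Granted the route's published inputs
`PublishedInputsAdditiveKoly` and McCallum's Cor. 5.6 divisibility half, the registered W-ALL leaf `WAllExclAdditive` (row 2, the
conclusion of the route's deciding theorem) follows from ILBᵃᵈᵈ (§3's displayed hypothesis) together with the route's OTHER cruxes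
`RankZeroAdditive` (r3), `OffSharpRankOneAdditive` (r4), `AdditiveAtThree` (r5) and `ManinGoodOddFrameAdditive` (the Manin frame,
itself glued from the Manin items in `closes`) — by the PROVED assembly (`AdditiveKoly.assembly`, item 20139) and the PROVED kernel
(`AdditiveKolyvaginKernel.additiveKolyvaginKernel_proof`, item 20138), with §3 supplying `KolyvaginPrimitiveAdditive`.  Neither KS′
(21396) nor BOT′ (21397) nor the E-side glue `KolyvaginPrimitiveOfLevelSystemsAdditive` appears.  CONDITIONAL on every antecedent
(ILBᵃᵈᵈ and r3–r5 are OPEN); a route-level reading for the pen, not a closure.  BSD is not proved by any of this.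
[cite: McCallumLMS1991, §5 Cor. 5.6 (p. 310)] [cite: JetchevSkinnerWan2017, §7.4.1] [cite: WZhang2014, Thm. 1.1] -/
theorem wAllExclAdditive_of_indexLowerBound (hPub : PublishedInputsAdditiveKoly)
    (hMc : McCallum1991_padicValNat_card_sha_primary_add_le_of_globalDivisibility)
    (hILB : ∀ (W : WeierstrassCurve ℚ) [W.IsElliptic] [W.IsGloballyMinimal] [NeZero (W.conductorNorm ℤ)]
      (p : ℕ) [Fact p.Prime] (K : Type) [Field K] [NumberField K]
      (Dt : ModularParametrizationData W (W.conductorNorm ℤ)) (β : ℤ) (ι : K →+* ℂ),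
      5 ≤ p → Addv W p → W.HasSurjectiveModNGaloisRep p →
      (∀ (ℓ : ℕ) [Fact ℓ.Prime], W.HasMultiplicativeReductionAtPrime ℓ → ¬ p ∣ padicValInt ℓ W.minimalDiscriminantInt) →
      (∃ (ℓ₁ ℓ₂ : ℕ) (_ : Fact ℓ₁.Prime) (_ : Fact ℓ₂.Prime), ℓ₁ ≠ ℓ₂ ∧
        W.HasMultiplicativeReductionAtPrime ℓ₁ ∧ W.HasMultiplicativeReductionAtPrime ℓ₂) →
      ¬ p ∣ W.tamagawaProduct → W.analyticRank = 1 → IsImaginaryQuadratic K → Odd (NumberField.discr K) →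
      NumberField.discr K < -4 → SatisfiesHeegnerHypothesis (W.conductorNorm ℤ) K →
      (W.quadraticTwist (NumberField.discr K : ℚ)).entireLFunction 1 ≠ 0 →
      (4 * (W.conductorNorm ℤ : ℤ)) ∣ β ^ 2 - NumberField.discr K → ¬ (p : ℤ) ∣ Dt.c →
      ∀ (H : HeegnerDatum (W.conductorNorm ℤ) (NumberField.discr K)) (P : (W.baseChange K).toAffine.Point),
        H.β = β → WeierstrassCurve.Affine.Point.map ι.toRatAlgHom P = heegnerPointComplex Dt H → ¬ IsOfFinAddOrder P →
        X11b.IndexLowerBoundAt W p K P)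
    (h₀ : RankZeroAdditive) (hoff : OffSharpRankOneAdditive) (h₃ : AdditiveAtThree) (hM : ManinGoodOddFrameAdditive) :
    Summit.BirchSwinnertonDyer.WAllExclAdditive :=
  assembly (kolyvaginPrimitiveAdditive_of_indexLowerBound hPub hMc hILB) h₀ hoff h₃ hM hPub
    AdditiveKolyvaginKernel.additiveKolyvaginKernel_proof

/-! ## §5 The converse: Kolyvagin's conjecture mod `p` GIVES the Heegner-index lower bound (McCallum's certificate half),
so that, modulo the published inputs, crux r2 and ILBᵃᵈᵈ are EQUIVALENT -/

section Converse

variable (W : WeierstrassCurve ℚ) [W.IsElliptic] [W.IsGloballyMinimal] [NeZero (W.conductorNorm ℤ)]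
  (p : ℕ) [hp : Fact p.Prime] (K : Type) [Field K] [NumberField K]
  (Dt : ModularParametrizationData W (W.conductorNorm ℤ)) (β : ℤ) (ι : K →+* ℂ)

/-- **A NON-ZERO mod-`p` Kolyvagin class forces the Heegner-index lower bound (one frame).**  Same frame as
`exists_kolyvaginClass_ne_zero_of_indexLowerBoundAt` (no `p ∤ ∏ c_ℓ` needed); published inputs Gross–Zagier, Kolyvagin, modularity
and McCallum's Cor. 5.6 CERTIFICATE half `hMcC` (`McCallum1991_pow_dvd_card_sha_primary_of_certificate`).  If some Kolyvagin–Heegner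
datum at a Kolyvagin level has `c(n) ≢ 0 (mod p)`, then `P_n ∉ p·E(K[n])` (Cor. 4.5, easy half) is a certificate at exponent `0`, so
`2·M₀ ≤ ord_p #Ш(E/K)[p^∞]` with `M₀ = ord_p [E(K) : ℤ y_K]` (Lemma 5.1) — which is `X11b.IndexLowerBoundAt W p K y_K` with room to
spare (`+ 2·ord_p ∏ c_ℓ ≥ 0`), at EVERY Heegner point `y_K` of the frame.  CONDITIONAL on every binder; nothing is booked.
[cite: McCallumLMS1991, §5 Cor. 5.6 (p. 310), Lemma 5.1, §4 Cor. 4.5] [cite: GrossLMS1991, (1.1), Thm. 1.3] -/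
theorem indexLowerBoundAt_of_exists_kolyvaginClass_ne_zero
    (hGZ : gross_zagier (W.conductorNorm ℤ) W K) (hKo : kolyvagin (W.conductorNorm ℤ) W K)
    (hmod : hasEntireLFunction_rat) (hMcC : McCallum1991_pow_dvd_card_sha_primary_of_certificate)
    (hp5 : 5 ≤ p) (hs : W.HasSurjectiveModNGaloisRep p) (hCM : ¬ W.HasCM) (hr : W.analyticRank = 1)
    (hK : IsImaginaryQuadratic K) (hlt : NumberField.discr K < -4)
    (hH : SatisfiesHeegnerHypothesis (W.conductorNorm ℤ) K)
    (hL : (W.quadraticTwist (NumberField.discr K : ℚ)).entireLFunction 1 ≠ 0)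
    (hβ : (4 * (W.conductorNorm ℤ : ℤ)) ∣ β ^ 2 - NumberField.discr K)
    (hprim : ∃ (n : ℕ) (d : KolyvaginHeegnerData Dt β ι n),
      KolyvaginDescent.KolSupp (Zhang2014.IsKolyvaginPrime (W.conductorNorm ℤ) W K p) n ∧
        d.kolyvaginClass hp.out 1 ≠ 0)
    (H : HeegnerDatum (W.conductorNorm ℤ) (NumberField.discr K)) (P : (W.baseChange K).toAffine.Point)
    (hHβ : H.β = β) (hP : WeierstrassCurve.Affine.Point.map ι.toRatAlgHom P = heegnerPointComplex Dt H) :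
    X11b.IndexLowerBoundAt W p K P := by
  have hpP : p.Prime := hp.out
  have hp2 : p ≠ 2 := by omega
  have hirr : W.HasIrreducibleModPGaloisRep p :=
    hasIrreducibleModPGaloisRep_of_hasSurjectiveModNGaloisRep W p hs
  have hsurjT : ∀ m : ℕ, W.HasSurjectiveModNGaloisRep (p ^ m : ℕ) :=
    serre_hasSurjectiveModNGaloisRep_pow_holds W p hp5 hs
  have h3 : NumberField.discr K ≠ -3 := by omega
  have h4 : NumberField.discr K ≠ -4 := by omega
  have hHP : IsHeegnerPoint (W.conductorNorm ℤ) W K P := ⟨Dt, H, ι, hP⟩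
  have hPinf : ¬ IsOfFinAddOrder P :=
    not_isOfFinAddOrder_of_heegner_of_analyticRank_eq_one W (W.conductorNorm ℤ) K Dt H ι P hGZ hmod hr hK hH hL hP
  obtain ⟨-, hSha⟩ := hKo hK hH hHP hPinf
  haveI : Finite (W.baseChange K).sha := hSha
  have hA : ∀ a : (W.baseChange K).toAffine.Point, (p : ℤ) • a = 0 → a = 0 := by
    intro a ha
    have hmem : a ∈ AddSubgroup.torsionBy (W.baseChange K).toAffine.Point (p : ℤ) :=
      (KolyvaginCocycle.mem_torsionBy_iff' (p : ℤ) a).mpr ha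
    rw [torsionBy_eq_bot_of_isImaginaryQuadratic_of_hasIrreducibleModPGaloisRep W K hK hpP hirr] at hmem
    exact (AddSubgroup.mem_bot).mp hmem
  have hidx : (AddSubgroup.zmultiples P).index ≠ 0 :=
    index_zmultiples_ne_zero_of_isHeegnerPoint (W.conductorNorm ℤ) W K hKo hK hH hHP hPinf
  set M₀ : ℕ := padicValNat p (AddSubgroup.zmultiples P).index with hM₀
  obtain ⟨hdiv, hndiv⟩ := Additive.zsmul_certificate_of_padicValNat_index hpP hA hPinf hidx hM₀.symm
  obtain ⟨d₁⟩ := nonempty_kolyvaginHeegnerData_one W K Dt β ι hK hβ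
  have hrec := heegnerPointOfConductor_one_galoisConj_holds (W.conductorNorm ℤ) W K
  have hPd : d₁.toGeomPoints d₁.derivedPoint = toGeomPoints (W.baseChange K) P :=
    KolyvaginBottom.toGeomPoints_derivedPoint_one_eq hrec hK hH hP d₁ hHβ
  -- the certificate at exponent `0`: a non-zero mod-`p` class at a Kolyvagin level is a non-divisible `P_n` (Cor. 4.5, easy half)
  obtain ⟨n, d, hn, hne⟩ := hprim
  have hℓ : ∀ ℓ ∈ n.primeFactors, Zhang2014.IsKolyvaginPrime (W.conductorNorm ℤ) W K p ℓ ∧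
      0 + 1 ≤ Zhang2014.kolyvaginIndex W p ℓ :=
    fun ℓ hℓ' ↦ ⟨hn.2 ℓ hℓ', (hn.2 ℓ hℓ').2.2.2.2.2⟩
  have hcert : ¬ ∃ Q : (W.baseChange (ringClassField K ι n)).toAffine.Point,
      ((p ^ (0 + 1) : ℕ) : ℤ) • Q = d.derivedPoint :=
    Koly.not_pDiv_of_kolyvaginClass_ne_zero d hne
  -- McCallum Cor. 5.6, certificate half: `2·(M₀ − 0) ≤ ord_p #Ш(E/K)[p^∞]`
  have hle := two_mul_sub_le_padicValNat_card_sha_primary_of_certificate hMcC W hCM K hK h3 h4 hH p hp2 hsurjT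
    Dt β ι d₁ P hPd hPinf hdiv hndiv d hn.1 hℓ hcert
  unfold X11b.IndexLowerBoundAt
  rw [WeierstrassCurve.shaOrder, ← padicValNat_card_addPrimaryComponent (A := (W.baseChange K).sha) p, ← hM₀]
  omega

end Converse

/-- **CRUX r2 ⟺ ILBᵃᵈᵈ, modulo the route's published inputs and McCallum's divisibility half.**  With
`PublishedInputsAdditiveKoly` (Gross–Zagier, Kolyvagin + his index bound, modularity, McCallum's Cor. 5.6 certificate half are used) and
the divisibility half `McCallum1991_padicValNat_card_sha_primary_add_le_of_globalDivisibility` as binders, Kolyvagin's conjecture mod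
`p` at every ♯ additive frame (`KolyvaginPrimitiveAdditive`) is EQUIVALENT to the Heegner-index lower bound at every ♯ additive frame
(ILBᵃᵈᵈ, §3's displayed statement): `⇐` is §3, `⇒` is §5 frame by frame (`¬CM` from a multiplicative prime).  So re-keying r2 as
ILBᵃᵈᵈ would neither lose nor gain strength modulo print; it changes the CURRENCY (an index inequality, the output shape of the printed
BDP ∕ anticyclotomic-IMC engines) — a reading for the pen, not acted on here.  CONDITIONAL; nothing is booked; BSD is not proved.
[cite: McCallumLMS1991, §5 Cor. 5.6 (p. 310)] [cite: JetchevSkinnerWan2017, §7.4.1–7.4.3] [cite: WZhang2014, Thm. 1.1, §9] -/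
theorem kolyvaginPrimitiveAdditive_iff_indexLowerBound (hPub : PublishedInputsAdditiveKoly)
    (hMc : McCallum1991_padicValNat_card_sha_primary_add_le_of_globalDivisibility) :
    KolyvaginPrimitiveAdditive ↔
    ∀ (W : WeierstrassCurve ℚ) [W.IsElliptic] [W.IsGloballyMinimal] [NeZero (W.conductorNorm ℤ)]
      (p : ℕ) [Fact p.Prime] (K : Type) [Field K] [NumberField K]
      (Dt : ModularParametrizationData W (W.conductorNorm ℤ)) (β : ℤ) (ι : K →+* ℂ),
      5 ≤ p → Addv W p → W.HasSurjectiveModNGaloisRep p →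
      (∀ (ℓ : ℕ) [Fact ℓ.Prime], W.HasMultiplicativeReductionAtPrime ℓ → ¬ p ∣ padicValInt ℓ W.minimalDiscriminantInt) →
      (∃ (ℓ₁ ℓ₂ : ℕ) (_ : Fact ℓ₁.Prime) (_ : Fact ℓ₂.Prime), ℓ₁ ≠ ℓ₂ ∧
        W.HasMultiplicativeReductionAtPrime ℓ₁ ∧ W.HasMultiplicativeReductionAtPrime ℓ₂) →
      ¬ p ∣ W.tamagawaProduct → W.analyticRank = 1 → IsImaginaryQuadratic K → Odd (NumberField.discr K) →
      NumberField.discr K < -4 → SatisfiesHeegnerHypothesis (W.conductorNorm ℤ) K →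
      (W.quadraticTwist (NumberField.discr K : ℚ)).entireLFunction 1 ≠ 0 →
      (4 * (W.conductorNorm ℤ : ℤ)) ∣ β ^ 2 - NumberField.discr K → ¬ (p : ℤ) ∣ Dt.c →
      ∀ (H : HeegnerDatum (W.conductorNorm ℤ) (NumberField.discr K)) (P : (W.baseChange K).toAffine.Point),
        H.β = β → WeierstrassCurve.Affine.Point.map ι.toRatAlgHom P = heegnerPointComplex Dt H → ¬ IsOfFinAddOrder P →
        X11b.IndexLowerBoundAt W p K P := by
  refine ⟨fun hKPA ↦ ?_, kolyvaginPrimitiveAdditive_of_indexLowerBound hPub hMc⟩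
  intro W _ _ _ p _ K _ _ Dt β ι hp5 hadd hs hsp htwo htam hr hK hodd hlt hH hL hβ hc H P hHβ hP _
  obtain ⟨hGZ, hKo, -, -, hmod, -, -, -, hMcC, -⟩ := hPub
  obtain ⟨ℓ₁, ℓ₂, hℓ₁, hℓ₂, hne, hm₁, hm₂⟩ := htwo
  have hCM : ¬ W.HasCM := not_hasCM_of_hasMultiplicativeReductionAtPrime' W hm₁
  exact indexLowerBoundAt_of_exists_kolyvaginClass_ne_zero W p K Dt β ι (hGZ _ W K) (hKo _ W K) hmod hMcC hp5 hs hCM hr hK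
    hlt hH hL hβ (hKPA W p K Dt β ι hp5 hadd hs hsp ⟨ℓ₁, ℓ₂, hℓ₁, hℓ₂, hne, hm₁, hm₂⟩ htam hr hK hodd hlt hH hL hβ hc) H P hHβ hP

end Summit.BirchSwinnertonDyer.BirchSwinnertonDyer.Theorems.AdditiveKoly

end
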